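import Summits.QuantumFields.YangMills.Theorems.BalabanUVNodesN11NoExpansionStepReductionRePinnedUnivECoPH
import Summits.QuantumFields.YangMills.Theorems.BalabanUVNodesN11Sect3SupplyDefs

/-!
# DAG node N11 — THEOREM 1's INDUCTIVE STEP AT A GENERIC v1.7 PARAMETER `θ`, REDUCED TO ITS TWO DELIVERABLES: the NO-EXPANSION 𝐓-CLAUSE for the exposed witness of `ρ_k`
# (dag-n11-d's lane, an INPUT here — whatever binders their current edition carries stay on their side) and [III] §3's supply at the EXPANSION sequences; the new-𝐄 clauses
# are NOT hypotheses (universality of 𝐄, this seat's `…RePinnedUnivECoPH` §0)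

Cell `pub-ymgap`, YM-PLAN Track A (HUMAN RULING D-0062), seat `pub-ymgap-dag-n11-e` (g14; R134 fan-out row N11∕s3), route `BalabanUVNodes` rev 25 (v1.7 `CoPH` key), item K1⁷
`StabilityBAtRecordR13SepCoPH` = stmt-QuantumFields-20542 (helper lane, count-neutral).  [III] = [Balaban1988Convergent], [IV] = [Balaban1989LargeFieldI].  Over this seat's
`…StepReductionCoPH` (p552803: §0 `lawsT_towerOfTerms_of_lawsRT_of_agree_of_newE`), `…TruncatedWitness` (p549689), `…GeneralStepLawsCoPH` (p550088), `…RePinnedUnivECoPH` (g14: §0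
`newEClauses_of_lawsT_of_eqE`), `…Sect3SupplyDefs` (g14: `truncAbove`) and `…B16RLeafRecord13LiveCoPH` (p540794).

WHY THIS FILE.  Every reduction of Theorem 1's step so far (F p552803 → J1 p565152 → J2 p566247 → `…RePinnedUnivECoPH`) CALLS dag-n11-d's no-expansion 𝐓-step INSIDE, so it
inherits whatever binders that step carries in the edition of the day (`hqloc ∕ hpre ∕ hZ ∕ hq` → discharged at `rePinH θ`; `hA` → fluctuation truncation p573517; `hmB` → graph
measurability, in flight; `hIB`).  THE ROBUST INTERFACE is the 𝐓-image CLAUSE ITSELF at the no-expansion sequences, for the exposed witness `(t (init s′), E_k(init s′))` —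
exactly what dag-n11-d's witness-first faces conclude — taken as an INPUT (`hTcl`).  With it the reduction is GENERIC in `θ : Stage13HParams` (no `rePinH`, no provisos, no
`k < K`: only `1 ≤ M` for the slot invariance above level `k`, the RG equation of the flow of record, and the signs `0 ≤ B₀, E₀`), and the new-𝐄 clauses are read off `hexp` as
in `…RePinnedUnivECoPH` (§0 there: the §2 tower's 𝐄-data do not read the history; `Stage13HParams.rzAt_bgI`).  HENCE:
§1 ★★★ `tLaw₁₃CoPH_of_formAtZS_of_newTerms_of_tClause_of_expansion` — `TLaw₁₃CoPH θ p k` from: the exposed witness `(t, E_k)` of the §2 form of `ρ_k`; a candidate family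
   `(tT, EkT)` universal in 𝐄 with the no-expansion bookkeeping (`hold ∕ hnoR ∕ hnoB ∕ hEk`); the no-expansion 𝐓-CLAUSE for `(t (init s′), E_k(init s′))` (`hTcl`); and [III]
   §3's deliverable at the expansion sequences (`hexp`: laws AND clause).  If no sequence of length `k+1` expands, the witness `truncAbove k (t (init s′))` serves instead and
   `hexp` is void.
§2 ★★★ `sLaw₁₃CoPH_succ_of_formAtZS_of_newTerms_of_tClause_of_expansion_of_liveSel` — hence `SLaw₁₃CoPH θ p (k+1)` on the live-selector line (row `rstep` of
   `θ.Provisos₁₃CoPH`, admissibility, the selector clause, `0 ≤ κ`, `k < K`).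
The successor `…ThmP245OfSect3SupplyCoPH` keys both deliverables on the named predicates `NoExpansionTStepAt` ∕ `Sect3SupplyAt` and closes the loop over the levels.

HONEST FRAMING.  Count-neutral kernel bookkeeping; `hTcl` (dag-n11-d's lane) and `hexp` ([III] §3 proper) are DISPLAYED, not proved; the zero branches are not excluded;
nothing of Bałaban asserted; N11 NOT discharged; K1⁷ NOT closed; counts unmoved (typed 28∕28 · discharged 5∕27).  One finite `𝕋⁴_{L^K}` programme at fixed `ε = L^{−K}`;
NOT ℝ⁴, NOT OS, NOT a mass gap, NOT Clay.
Sources: [III] Theorem p.245, Thm 1 p.262, §2 p.262, (2.17)–(2.18) p.257, (2.20)–(2.31) pp.258–260, (2.25)–(2.28) p.259, (2.40)–(2.42) p.261, (3.24)–(3.25) p.270, p.279;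
[IV] (0.2)–(0.4) p.176, p.177 (i)–(ii); [Balaban1987RG1] (0.20) p.256.
-/

noncomputable section

open MeasureTheory
open scoped BigOperators Matrix.Norms.L2Operator

namespace Summit.QuantumFields.YangMills.Theorems.BalabanUVNodesN11NoExpansionStepReductionTClauseUnivECoPH

open Literature.MathematicalPhysics.QuantumFieldTheory.Balaban1983to89 T4Continuum Node00 Node00.Tk DagBinding
open Literature.MathematicalPhysics.QuantumFieldTheory.Balaban1983to89.B16RLeafRecord13LiveCoPH (sLaw₁₃CoPH_succ_of_tLaw₁₃CoPH_of_liveSel_of_rstep)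
open BalabanUVNodesN11NoExpansionTruncatedWitness (sect2Slot_succ_congr_of_agree_of_Omega_empty)
open BalabanUVNodesN11NoExpansionGeneralStepLawsCoPH (sect2TowerOfRecord_rzAt_succ_eq_init_of_Omega_empty)
open BalabanUVNodesN11NoExpansionStepReductionCoPH (lawsT_towerOfTerms_of_lawsRT_of_agree_of_newE)
open BalabanUVNodesN11NoExpansionStepReductionRePinnedUnivECoPH (newEClauses_of_lawsT_of_eqE)
open BalabanUVNodesN11Sect3SupplyDefs (truncAbove truncAbove_E_of_le truncAbove_R_of_le truncAbove_B_of_le universalE_truncAbove_comp lawsT_towerOfTerms_truncAbove_of_lawsRT)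

variable {F : T4Family} {N : ℕ} [NeZero N]
variable (θ : Stage13HParams F N) (p : B12.RunParams)

/-! ## §1. `TLaw₁₃CoPH θ p k` from the exposed witness, the candidate's bookkeeping, the no-expansion 𝐓-clause and [III] §3's supply -/

section Reduction

/-- **★★★ `TLaw₁₃CoPH θ p k` — THE 𝐓-IMAGE HasSect2FormAtZS F N (FluctV N) p.K (settingOfRecord₁₃ F N θ.toStage13Params p) k (θ.rzAt p) (WtOfRecord₁₃H F N θ p)
      (UbgOfRecord₁₃CoP F N θ.toStage13Params p k)
      (fun s u => Sect2.LawsRT (sect2TowerOfRecord F N (FluctV N) p.K (settingOfRecord₁₃ F N θ.toStage13Params p) (θ.rzAt p s) s u)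
        (settingOfRecord₁₃ F N θ.toStage13Params p).lf k)
      (slotsOfRecord F N θ.ν θ.τ9 (EOfRecord₁₃ F N θ.toStage13Params) (wOfRecord₉ F N θ.toStage9Params) θ.ppSel p (gOfRecord₁₃ F N θ.toStage13Params p) k) t Ek OF `𝐓ρ_k` AT EVERY NEW SEQUENCE — FROM ITS TWO DELIVERABLES**, generic `θ : Stage13HParams`: the exposed witness `(t, E_k)` of
the §2 form of `ρ_k` (`hS` — the unfolding of `SLaw₁₃CoPH θ p k`); a candidate family `(tT, EkT)` universal in 𝐄 keeping the old terms, without `𝐑^{(k+1)} ∕ 𝐁^{(k+1)}` and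
with `E_{k+1} = E_k` at the no-expansion sequences (`huT ∕ hold ∕ hnoR ∕ hnoB ∕ hEk`); THE NO-EXPANSION 𝐓-CLAUSE for the old terms `(t (init s′), E_k(init s′))` at every `s′`
with `Ω_{k+1}(s′) = ∅` (`hTcl` — dag-n11-d's lane, an input); [III] §3's deliverable at every `s′` with `Ω_{k+1}(s′) ≠ ∅` (`hexp` — laws `Sect2.LawsT … k` AND the clause for
the candidate).  Only `1 ≤ M` and `0 ≤ B₀, E₀` besides.  Proof: if some sequence expands, the candidate IS a `TLaw` witness — at a no-expansion `s′` its laws come from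
`LawsRT … k` of `t (init s′)` (the tower at `s′` is the one at `init s′`, p550088) plus r11's new-𝐄 clauses READ OFF `(hexp s₁).1` by universality (`…RePinnedUnivECoPH` §0) and
no new `𝐑 ∕ 𝐁` (p552803 §0), and its clause is `hTcl` transported by the slot invariance above level `k` (p549689); if none expands, `s′ ↦ truncAbove k (t (init s′))` is a
witness (`…Sect3SupplyDefs.lawsT_towerOfTerms_truncAbove_of_lawsRT`, same clause transport) and `hexp` is void.
[cite: Balaban1988Convergent, Theorem p.245, Thm 1 p.262, §2 p.262, (3.24)–(3.25) p.270, (2.18) p.257, (2.20)–(2.31) pp.258–260, (2.40)–(2.42) p.261, p.279; Balaban1987RG1, (0.20) p.256] -/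
theorem tLaw₁₃CoPH_of_formAtZS_of_newTerms_of_tClause_of_expansion {k : ℕ} (hM : 1 ≤ θ.τ9.M) (hB₀ : 0 ≤ θ.s2.lf.B₀) (hE₀ : 0 ≤ θ.s2.lf.E₀)
    (t : SeqOfRecord F θ.ν θ.τ9.M (gOfRecord₁₃ F N θ.toStage13Params p) p.K k → Sect2.TermValues (F.P p.K) (MatA N) (FluctV N) θ.τ9.M)
    (Ek : SeqOfRecord F θ.ν θ.τ9.M (gOfRecord₁₃ F N θ.toStage13Params p) p.K k → ℝ)
    (hS : HasSect2FormAtZS F N (FluctV N) p.K (settingOfRecord₁₃ F N θ.toStage13Params p) k (θ.rzAt p) (WtOfRecord₁₃H F N θ p)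
      (UbgOfRecord₁₃CoP F N θ.toStage13Params p k)
      (fun s u => Sect2.LawsRT (sect2TowerOfRecord F N (FluctV N) p.K (settingOfRecord₁₃ F N θ.toStage13Params p) (θ.rzAt p s) s u)
        (settingOfRecord₁₃ F N θ.toStage13Params p).lf k)
      (slotsOfRecord F N θ.ν θ.τ9 (EOfRecord₁₃ F N θ.toStage13Params) (wOfRecord₉ F N θ.toStage9Params) θ.ppSel p (gOfRecord₁₃ F N θ.toStage13Params p) k) t Ek)
    (tT : SeqOfRecord F θ.ν θ.τ9.M (gOfRecord₁₃ F N θ.toStage13Params p) p.K (k + 1) → Sect2.TermValues (F.P p.K) (MatA N) (FluctV N) θ.τ9.M)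
    (EkT : SeqOfRecord F θ.ν θ.τ9.M (gOfRecord₁₃ F N θ.toStage13Params p) p.K (k + 1) → ℝ) (huT : Sect2.UniversalE tT)
    (hold : ∀ s : SeqOfRecord F θ.ν θ.τ9.M (gOfRecord₁₃ F N θ.toStage13Params p) p.K (k + 1), s.Ω (k + 1) = ∅ →
      (∀ j, j ≤ k → ∀ X z g φ, (tT s).E j X z g φ = (t s.init).E j X z g φ) ∧ (∀ j, j ≤ k → ∀ X φ, (tT s).R j X φ = (t s.init).R j X φ) ∧
        (∀ j, j ≤ k → ∀ X φ a, (tT s).B j X φ a = (t s.init).B j X φ a))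
    (hnoR : ∀ s : SeqOfRecord F θ.ν θ.τ9.M (gOfRecord₁₃ F N θ.toStage13Params p) p.K (k + 1), s.Ω (k + 1) = ∅ → ∀ X φ, (tT s).R (k + 1) X φ = 0)
    (hnoB : ∀ s : SeqOfRecord F θ.ν θ.τ9.M (gOfRecord₁₃ F N θ.toStage13Params p) p.K (k + 1), s.Ω (k + 1) = ∅ → ∀ X φ a, (tT s).B (k + 1) X φ a = 0)
    (hEk : ∀ s : SeqOfRecord F θ.ν θ.τ9.M (gOfRecord₁₃ F N θ.toStage13Params p) p.K (k + 1), s.Ω (k + 1) = ∅ → EkT s = Ek s.init)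
    (hTcl : ∀ s : SeqOfRecord F θ.ν θ.τ9.M (gOfRecord₁₃ F N θ.toStage13Params p) p.K (k + 1), s.Ω (k + 1) = ∅ →
      slotsTOfRecord F N θ.ν θ.τ9 (EOfRecord₁₃ F N θ.toStage13Params) (wOfRecord₉ F N θ.toStage9Params) θ.ppSel p
          (gOfRecord₁₃ F N θ.toStage13Params p) (k + 1) s = 0 ∨
        ∀ᵐ V' ∂fieldMeasure (F.P p.K) (k + 1) (SU N),
          chiSeqOfRecord F N θ.ν θ.τ9.M (gOfRecord₁₃ F N θ.toStage13Params p) p.K (k + 1) s V' ≠ 0 →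
            slotsTOfRecord F N θ.ν θ.τ9 (EOfRecord₁₃ F N θ.toStage13Params) (wOfRecord₉ F N θ.toStage9Params) θ.ppSel p
                (gOfRecord₁₃ F N θ.toStage13Params p) (k + 1) s V' =
              sect2Slot F N (FluctV N) p.K (settingOfRecord₁₃ F N θ.toStage13Params p) (θ.rzAt p s) (WtOfRecord₁₃H F N θ p s) s (t s.init) (Ek s.init)
                (UbgOfRecord₁₃CoP F N θ.toStage13Params p (k + 1) s) V')
    (hexp : ∀ s : SeqOfRecord F θ.ν θ.τ9.M (gOfRecord₁₃ F N θ.toStage13Params p) p.K (k + 1), s.Ω (k + 1) ≠ ∅ →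
      Sect2.LawsT (sect2TowerOfRecord F N (FluctV N) p.K (settingOfRecord₁₃ F N θ.toStage13Params p) (θ.rzAt p s) s (tT s))
          (settingOfRecord₁₃ F N θ.toStage13Params p).lf (settingOfRecord₁₃ F N θ.toStage13Params p).βc k ∧
        (slotsTOfRecord F N θ.ν θ.τ9 (EOfRecord₁₃ F N θ.toStage13Params) (wOfRecord₉ F N θ.toStage9Params) θ.ppSel p
            (gOfRecord₁₃ F N θ.toStage13Params p) (k + 1) s = 0 ∨
          ∀ᵐ V' ∂fieldMeasure (F.P p.K) (k + 1) (SU N),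
            chiSeqOfRecord F N θ.ν θ.τ9.M (gOfRecord₁₃ F N θ.toStage13Params p) p.K (k + 1) s V' ≠ 0 →
              slotsTOfRecord F N θ.ν θ.τ9 (EOfRecord₁₃ F N θ.toStage13Params) (wOfRecord₉ F N θ.toStage9Params) θ.ppSel p
                  (gOfRecord₁₃ F N θ.toStage13Params p) (k + 1) s V' =
                sect2Slot F N (FluctV N) p.K (settingOfRecord₁₃ F N θ.toStage13Params p) (θ.rzAt p s) (WtOfRecord₁₃H F N θ p s) s (tT s) (EkT s)
                  (UbgOfRecord₁₃CoP F N θ.toStage13Params p (k + 1) s) V')) :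
    TLaw₁₃CoPH F N θ p k := by
  classical
  obtain ⟨hu, hs⟩ := hS
  have hrg := settingOfRecord₁₃_satisfiesRG F N θ.toStage13Params p (k + 1) k (Nat.lt_succ_self k)
  have hg := B16RLeafRecord13Live.gOfRecord₁₃_succ_nonneg F N θ.toStage13Params p k
  -- the inductive laws of the old terms hold on the tower AT THE NEW no-expansion sequence (the tower at `s′` is the one at `init s′`)
  have hlaw : ∀ s : SeqOfRecord F θ.ν θ.τ9.M (gOfRecord₁₃ F N θ.toStage13Params p) p.K (k + 1), s.Ω (k + 1) = ∅ →
      Sect2.LawsRT (sect2TowerOfRecord F N (FluctV N) p.K (settingOfRecord₁₃ F N θ.toStage13Params p) (θ.rzAt p s) s (t s.init)) (settingOfRecord₁₃ F N θ.toStage13Params p).lf k := fun s hΩ => by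
    rw [sect2TowerOfRecord_rzAt_succ_eq_init_of_Omega_empty θ p s hΩ (t s.init)]; exact (hs s.init).1
  by_cases hex : ∃ s₁ : SeqOfRecord F θ.ν θ.τ9.M (gOfRecord₁₃ F N θ.toStage13Params p) p.K (k + 1), s₁.Ω (k + 1) ≠ ∅
  · -- SOME sequence expands: the candidate family is a witness; the new-𝐄 clauses come from `(hexp s₁).1` by universality
    obtain ⟨s₁, hs₁⟩ := hex
    have hC := fun s : SeqOfRecord F θ.ν θ.τ9.M (gOfRecord₁₃ F N θ.toStage13Params p) p.K (k + 1) =>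
      newEClauses_of_lawsT_of_eqE (V := FluctV N) (settingOfRecord₁₃ F N θ.toStage13Params p) (Rz := θ.rzAt p s₁) (Rz' := θ.rzAt p s) rfl s₁.Ω s.Ω (huT s s₁) (hexp s₁ hs₁).1
    refine (tLaw₁₃CoPH_iff F N θ p k).mpr ⟨tT, EkT, huT, fun s => ?_⟩
    by_cases hΩ : s.Ω (k + 1) = ∅
    · obtain ⟨hE, hR, hB⟩ := hold s hΩ
      refine ⟨lawsT_towerOfTerms_of_lawsRT_of_agree_of_newE _ _ _ hE hR hB (hnoR s hΩ) (hnoB s hΩ) (hC s).1 (hC s).2.1 (hC s).2.2.1 (hC s).2.2.2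
        (hlaw s hΩ) hrg hB₀ hg, ?_⟩
      rw [hEk s hΩ, sect2Slot_succ_congr_of_agree_of_Omega_empty (FluctV N) _ _ _ hM s hΩ hE hR hB]
      exact hTcl s hΩ
    · exact hexp s hΩ
  · -- NO sequence expands: the witness truncated above level `k` serves every sequence; `hexp` is void
    push Not at hex
    refine (tLaw₁₃CoPH_iff F N θ p k).mpr ⟨fun s => truncAbove k (t s.init), fun s => Ek s.init, universalE_truncAbove_comp hu k _, fun s => ?_⟩
    refine ⟨lawsT_towerOfTerms_truncAbove_of_lawsRT _ _ _ (hlaw s (hex s)) hrg hE₀ hB₀ hg, ?_⟩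
    rw [sect2Slot_succ_congr_of_agree_of_Omega_empty (FluctV N) _ _ _ hM s (hex s) (fun j hj X z g φ => truncAbove_E_of_le _ hj X z g φ)
      (fun j hj X φ => truncAbove_R_of_le _ hj X φ) (fun j hj X φ a => truncAbove_B_of_le _ hj X φ a)]
    exact hTcl s (hex s)

/-! ## §2. Hence `SLaw₁₃CoPH θ p (k+1)` on the live-selector line -/

/-- **★★★ … HENCE `SLaw₁₃CoPH θ p (k+1)` ON THE LIVE-SELECTOR LINE** — Theorem 1's complete inductive step `ρ_k ↦ ρ_{k+1}` at a generic v1.7 parameter from its two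
deliverables (the no-expansion 𝐓-clause `hTcl`, [III] §3's supply `hexp`), the exposed witness and the candidate's bookkeeping, through this seat's live-line 𝐑-step
(`…LiveCoPH.sLaw₁₃CoPH_succ_of_tLaw₁₃CoPH_of_liveSel_of_rstep`: row `rstep` of `θ.Provisos₁₃CoPH`, admissibility, the selector clause, the signs `0 ≤ κ, E₀, B₀`, `k < K`).
[cite: Balaban1988Convergent, Thm 1 p.262, Theorem p.245, §2 p.262, (3.24)–(3.25) p.270, (2.17)–(2.18) p.257, p.279; Balaban1989LargeFieldI, (0.2)–(0.4) p.176, p.177 (i)–(ii)] -/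
theorem sLaw₁₃CoPH_succ_of_formAtZS_of_newTerms_of_tClause_of_expansion_of_liveSel (h : θ.Provisos₁₃CoPH F N)
    (hsel : θ.ppSel = ppSelLiveOfRecord F N θ.ν θ.τ9 (EOfRecord₁₃ F N θ.toStage13Params) (wOfRecord₉ F N θ.toStage9Params))
    (hθ : θ.Admissible F N) (hκ : 0 ≤ θ.s2.lf.κ) (hE₀ : 0 ≤ θ.s2.lf.E₀) (hB₀ : 0 ≤ θ.s2.lf.B₀) {k : ℕ} (hk : k < p.K) (hM : 1 ≤ θ.τ9.M)
    (t : SeqOfRecord F θ.ν θ.τ9.M (gOfRecord₁₃ F N θ.toStage13Params p) p.K k → Sect2.TermValues (F.P p.K) (MatA N) (FluctV N) θ.τ9.M)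
    (Ek : SeqOfRecord F θ.ν θ.τ9.M (gOfRecord₁₃ F N θ.toStage13Params p) p.K k → ℝ)
    (hS : HasSect2FormAtZS F N (FluctV N) p.K (settingOfRecord₁₃ F N θ.toStage13Params p) k (θ.rzAt p) (WtOfRecord₁₃H F N θ p)
      (UbgOfRecord₁₃CoP F N θ.toStage13Params p k)
      (fun s u => Sect2.LawsRT (sect2TowerOfRecord F N (FluctV N) p.K (settingOfRecord₁₃ F N θ.toStage13Params p) (θ.rzAt p s) s u)
        (settingOfRecord₁₃ F N θ.toStage13Params p).lf k)
      (slotsOfRecord F N θ.ν θ.τ9 (EOfRecord₁₃ F N θ.toStage13Params) (wOfRecord₉ F N θ.toStage9Params) θ.ppSel p (gOfRecord₁₃ F N θ.toStage13Params p) k) t Ek)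
    (tT : SeqOfRecord F θ.ν θ.τ9.M (gOfRecord₁₃ F N θ.toStage13Params p) p.K (k + 1) → Sect2.TermValues (F.P p.K) (MatA N) (FluctV N) θ.τ9.M)
    (EkT : SeqOfRecord F θ.ν θ.τ9.M (gOfRecord₁₃ F N θ.toStage13Params p) p.K (k + 1) → ℝ) (huT : Sect2.UniversalE tT)
    (hold : ∀ s : SeqOfRecord F θ.ν θ.τ9.M (gOfRecord₁₃ F N θ.toStage13Params p) p.K (k + 1), s.Ω (k + 1) = ∅ →
      (∀ j, j ≤ k → ∀ X z g φ, (tT s).E j X z g φ = (t s.init).E j X z g φ) ∧ (∀ j, j ≤ k → ∀ X φ, (tT s).R j X φ = (t s.init).R j X φ) ∧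
        (∀ j, j ≤ k → ∀ X φ a, (tT s).B j X φ a = (t s.init).B j X φ a))
    (hnoR : ∀ s : SeqOfRecord F θ.ν θ.τ9.M (gOfRecord₁₃ F N θ.toStage13Params p) p.K (k + 1), s.Ω (k + 1) = ∅ → ∀ X φ, (tT s).R (k + 1) X φ = 0)
    (hnoB : ∀ s : SeqOfRecord F θ.ν θ.τ9.M (gOfRecord₁₃ F N θ.toStage13Params p) p.K (k + 1), s.Ω (k + 1) = ∅ → ∀ X φ a, (tT s).B (k + 1) X φ a = 0)
    (hEk : ∀ s : SeqOfRecord F θ.ν θ.τ9.M (gOfRecord₁₃ F N θ.toStage13Params p) p.K (k + 1), s.Ω (k + 1) = ∅ → EkT s = Ek s.init)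
    (hTcl : ∀ s : SeqOfRecord F θ.ν θ.τ9.M (gOfRecord₁₃ F N θ.toStage13Params p) p.K (k + 1), s.Ω (k + 1) = ∅ →
      slotsTOfRecord F N θ.ν θ.τ9 (EOfRecord₁₃ F N θ.toStage13Params) (wOfRecord₉ F N θ.toStage9Params) θ.ppSel p
          (gOfRecord₁₃ F N θ.toStage13Params p) (k + 1) s = 0 ∨
        ∀ᵐ V' ∂fieldMeasure (F.P p.K) (k + 1) (SU N),
          chiSeqOfRecord F N θ.ν θ.τ9.M (gOfRecord₁₃ F N θ.toStage13Params p) p.K (k + 1) s V' ≠ 0 →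
            slotsTOfRecord F N θ.ν θ.τ9 (EOfRecord₁₃ F N θ.toStage13Params) (wOfRecord₉ F N θ.toStage9Params) θ.ppSel p
                (gOfRecord₁₃ F N θ.toStage13Params p) (k + 1) s V' =
              sect2Slot F N (FluctV N) p.K (settingOfRecord₁₃ F N θ.toStage13Params p) (θ.rzAt p s) (WtOfRecord₁₃H F N θ p s) s (t s.init) (Ek s.init)
                (UbgOfRecord₁₃CoP F N θ.toStage13Params p (k + 1) s) V')
    (hexp : ∀ s : SeqOfRecord F θ.ν θ.τ9.M (gOfRecord₁₃ F N θ.toStage13Params p) p.K (k + 1), s.Ω (k + 1) ≠ ∅ →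
      Sect2.LawsT (sect2TowerOfRecord F N (FluctV N) p.K (settingOfRecord₁₃ F N θ.toStage13Params p) (θ.rzAt p s) s (tT s))
          (settingOfRecord₁₃ F N θ.toStage13Params p).lf (settingOfRecord₁₃ F N θ.toStage13Params p).βc k ∧
        (slotsTOfRecord F N θ.ν θ.τ9 (EOfRecord₁₃ F N θ.toStage13Params) (wOfRecord₉ F N θ.toStage9Params) θ.ppSel p
            (gOfRecord₁₃ F N θ.toStage13Params p) (k + 1) s = 0 ∨
          ∀ᵐ V' ∂fieldMeasure (F.P p.K) (k + 1) (SU N),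
            chiSeqOfRecord F N θ.ν θ.τ9.M (gOfRecord₁₃ F N θ.toStage13Params p) p.K (k + 1) s V' ≠ 0 →
              slotsTOfRecord F N θ.ν θ.τ9 (EOfRecord₁₃ F N θ.toStage13Params) (wOfRecord₉ F N θ.toStage9Params) θ.ppSel p
                  (gOfRecord₁₃ F N θ.toStage13Params p) (k + 1) s V' =
                sect2Slot F N (FluctV N) p.K (settingOfRecord₁₃ F N θ.toStage13Params p) (θ.rzAt p s) (WtOfRecord₁₃H F N θ p s) s (tT s) (EkT s)
                  (UbgOfRecord₁₃CoP F N θ.toStage13Params p (k + 1) s) V')) :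
    SLaw₁₃CoPH F N θ p (k + 1) :=
  sLaw₁₃CoPH_succ_of_tLaw₁₃CoPH_of_liveSel_of_rstep F N θ p (fun q j _ hj => h.rstep q j hj) hθ hκ hE₀ hB₀ hsel k hk
    (tLaw₁₃CoPH_of_formAtZS_of_newTerms_of_tClause_of_expansion θ p hM hB₀ hE₀ t Ek hS tT EkT huT hold hnoR hnoB hEk hTcl hexp)

end Reduction

end Summit.QuantumFields.YangMills.Theorems.BalabanUVNodesN11NoExpansionStepReductionTClauseUnivECoPH

end
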